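import Summits.Ventures.HSemireg.WedgeHankelCoSiegel
import Summits.Ventures.HSemireg.WedgeHankelDivisorImage

/-!
# Venture HSemireg — THE CO-SIEGEL `n`-FORMS ARE EXACTLY TH-7's CLASSES: `coSiegel(n) = span{w_n(q)} = ⨁_{p ≤ n} K·w_n(δ_p)`, and `coSiegel(j) = 0` for `j < n`
# — a degree-`n` form is killed by every Siegel 2-vector iff it is a class `w_n(q)`

HONEST FRAMING. Part of the Lean index of the computation cell `pub-hsemireg` (seat p10 gen 16, Sunday typer «UNIFORM-IN-n»).
Finite-dimensional EXTERIOR ALGEBRA over a field ONLY: no variety, no cohomology theory, no sheaf, no Ext group, no semiregularity map;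
nothing here says that HC / HC_CM / HC_AV holds; no Literature fact is declared or used.  The dictionary (`w_n(q)` ↔ the class `Σ_j q_j Θ^j/j!`; `w_n(δ_p)` ↔ `E_p = Θ^p/p!`)
is QUOTED, never asserted.

WHAT IS IN THE TREE.  F4 (`coSiegel`, `finrank_coSiegel`: `dim coSiegel(j) = (k+1)·C(n,k)`, `k + j = 2n`), gen 11 (`w_mul_sv`: every class is killed by every Siegel 2-vector; `w_top_mem_Hom`),
(10) `w_spike_mem_plane` (`w_n(δ_p) ∈ plane(n−p, p)`), E2 (`prj`, `prj_of_mem_plane(_ne)`), F2d `finrank_V_w` + E6 `rank_hankel1_of_order` (so `w_n(δ_p) ≠ 0`).  THIS FILE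
(namespace `Summit.Ventures.HSemireg.Wedge.KernelDuality` continued):
* §78 `coSiegel_eq_bot_of_lt`: **`coSiegel(j) = 0` for `j < n`** (its dimension is `(2n−j+1)·C(n, 2n−j) = 0`).
* §79 `w_spike_ne_zero`; `linearIndependent_w_spike`: the `n + 1` classes `w_n(δ_0), …, w_n(δ_n)` are linearly independent (they live in the distinct blocks `plane(n−p, p)`);
  `w_mem_coSiegel`: every class is a co-Siegel `n`-form; **`coSiegel_n_eq_span_w_spike`: `coSiegel(n) = span{w_n(δ_p) : p ≤ n}`** and **`coSiegel_n_eq_span_w`: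
  `coSiegel(n) = span{w_n(q) : q}`** — the degree-`n` forms killed by every Siegel 2-vector are EXACTLY th-7's classes (dimension `n + 1`); `mem_coSiegel_n_iff`.
Class side only; new names only.
-/

open Module

namespace Summit.Ventures.HSemireg.Wedge.KernelDuality

open Summit.Ventures.HSemireg.Wedge Summit.Ventures.HSemireg.Wedge.Kunneth Summit.Ventures.HSemireg.Wedge.Hankel
  Summit.Ventures.HSemireg.Wedge.HankelSiegel Summit.Ventures.HSemireg.Wedge.HankelSiegelIdeal Summit.Ventures.HSemireg.Wedge.KunnethKernel
  Summit.Ventures.HSemireg.Wedge.HankelSecant Summit.Ventures.HSemireg.Wedge.HankelFrameChange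

variable (K : Type*) [Field K] {n : ℕ}

/-! ## §78. Below degree `n` there are no co-Siegel forms -/

/-- **`coSiegel(j) = ⊥` for `j < n`** — by F4's count its dimension is `(k+1)·C(n,k)` with `k = 2n − j > n`. -/
theorem coSiegel_eq_bot_of_lt {j : ℕ} (hj : j < n) : coSiegel K n j = ⊥ := by
  rw [← Submodule.finrank_eq_zero, finrank_coSiegel K (k := n + n - j) (j := j) (by omega), Nat.choose_eq_zero_of_lt (by omega), mul_zero]

/-! ## §79. In degree `n` the co-Siegel forms are the classes -/

/-- `w_n(δ_p) ≠ 0` for `p ≤ n` (its degree-`0` image has dimension `C(n,0)·rank H_0(δ_p) = 1`). -/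
theorem w_spike_ne_zero {p : ℕ} (hp : p ≤ n) : w K n n (fun j => if j = p then (1 : K) else 0) ≠ 0 := by
  intro h0
  have h := finrank_V_w K (n := n) 0 (fun j => if j = p then (1 : K) else 0)
  rw [rank_hankel1_of_order K (k := 0) (P := p) (by omega) (fun j hj => if_neg (by omega)) (by rw [if_pos rfl]; exact one_ne_zero),
    Nat.choose_zero_right, h0] at h
  have hV : V K (In n) Finset.univ (0 : HT K (In n)) 0 = ⊥ := by
    rw [V_eq_map, Submodule.eq_bot_iff]
    rintro _ ⟨θ, -, rfl⟩
    rw [LinearMap.mulRight_apply, mul_zero]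
  rw [hV, finrank_bot] at h
  simp at h

/-- **every class is a co-Siegel `n`-form**: `w_n(q) ∈ coSiegel(n)` (gen 11's `w_mul_sv`). -/
theorem w_mem_coSiegel (q : ℕ → K) : w K n n q ∈ coSiegel K n n := by
  refine mem_coSiegel.mpr ⟨w_top_mem_Hom K q, fun p => ?_⟩
  rw [sgen]; exact w_mul_sv K (SIdx_lt p).1 (SIdx_lt p).2 q

/-- **the spike classes `w_n(δ_0), …, w_n(δ_n)` are linearly independent** (each lives in its own block `plane(n−p, p)`). -/
theorem linearIndependent_w_spike : LinearIndependent K (fun p : Fin (n + 1) => w K n n (fun j => if j = (p : ℕ) then (1 : K) else 0)) := by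
  rw [linearIndependent_iff']
  intro s g hg i hi
  have hmem : ∀ p : Fin (n + 1), w K n n (fun j => if j = (p : ℕ) then (1 : K) else 0) ∈ plane K n (n - (p : ℕ)) (p : ℕ) := fun p =>
    w_spike_mem_plane K le_rfl (by have := p.2; omega)
  have h := congrArg (prj K n (n - (i : ℕ)) (i : ℕ)) hg
  rw [map_sum, map_zero, Finset.sum_eq_single i] at h
  · rw [map_smul, prj_of_mem_plane K (hmem i)] at h
    exact (smul_eq_zero.mp h).resolve_right (w_spike_ne_zero K (by have := i.2; omega))
  · intro p _ hpi
    have hne : (p : ℕ) ≠ (i : ℕ) := fun e => hpi (Fin.ext e)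
    rw [map_smul, prj_of_mem_plane_ne K (Or.inr (Ne.symm hne)) (hmem p), smul_zero]
  · intro h'; exact absurd hi h'

/-- **`coSiegel(n) = span{w_n(δ_p) : p ≤ n}`**: the `n + 1` spike classes span the co-Siegel `n`-forms (independent, inside, and `dim coSiegel(n) = n + 1`). -/
theorem coSiegel_n_eq_span_w_spike :
    coSiegel K n n = Submodule.span K (Set.range (fun p : Fin (n + 1) => w K n n (fun j => if j = (p : ℕ) then (1 : K) else 0))) := by
  symm
  apply Submodule.eq_of_le_of_finrank_eq
  · rw [Submodule.span_le]; rintro _ ⟨p, rfl⟩; exact w_mem_coSiegel K _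
  · rw [finrank_span_eq_card (linearIndependent_w_spike K), Fintype.card_fin,
      finrank_coSiegel K (k := n) (j := n) (by omega), Nat.choose_self, mul_one]

/-- **THE CO-SIEGEL `n`-FORMS ARE EXACTLY TH-7's CLASSES: `coSiegel(n) = span{w_n(q) : q}`.** -/
theorem coSiegel_n_eq_span_w : coSiegel K n n = Submodule.span K (Set.range (fun q : ℕ → K => w K n n q)) := by
  apply le_antisymm
  · rw [coSiegel_n_eq_span_w_spike]
    exact Submodule.span_mono (by rintro _ ⟨p, rfl⟩; exact ⟨_, rfl⟩)
  · rw [Submodule.span_le]; rintro _ ⟨q, rfl⟩; exact w_mem_coSiegel K q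

/-- membership form: a degree-`n` form is killed by every Siegel 2-vector iff it lies in the span of th-7's classes. -/
theorem mem_coSiegel_n_iff {θ : HT K (In n)} : θ ∈ coSiegel K n n ↔ θ ∈ Submodule.span K (Set.range (fun q : ℕ → K => w K n n q)) := by
  rw [coSiegel_n_eq_span_w]

/-- `dim coSiegel(n) = n + 1`. -/
theorem finrank_coSiegel_n : finrank K (coSiegel K n n) = n + 1 := by
  rw [finrank_coSiegel K (k := n) (j := n) (by omega), Nat.choose_self, mul_one]

end Summit.Ventures.HSemireg.Wedge.KernelDuality
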